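import Summits.BirchSwinnertonDyer.Rank1Residual.X2.GreenbergVatsalTateKummerLocal
import Literature.NumberTheory.EllipticCurves.Greenberg1999.LocalH1DivisibleCyclotomicProofs
import Literature.NumberTheory.EllipticCurves.KummerSelmerStructure
import HarnessLib

/-!
# Greenberg LNM 1716, proof of Prop. 2.4 (p. 75) for the Tate line: `cd_p(G_K) ≤ 1 ⟹ H¹(K, C_v)`
# is `2`-divisible, in cochain form, for `K = (F_∞)_η` the cyclotomic tower — the `p = 2` input
# of the discharge of `Greenberg1999.imKummer_ge_strictCondition_multiplicative_cyclotomic`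

HONEST FRAMING (cell `pub/bsd-cited`, ARM P of the BSD rank-`≤ 1` literature-to-partition
programme; seat `bsd-cited-r09`, base-role literature-prover work): nothing here proves BSD or
moves a class label. THEOREMS ONLY (no `def`, no named fact). This file and its sibling
`GreenbergVatsalTateKummerCyclotomic` turn ONE named PRINT fact of the tree into a kernel theorem
(D-0026: debt `−1`): the `p = 2`-admitting companion
`Greenberg1999.imKummer_ge_strictCondition_multiplicative_cyclotomic` of the fact discharged for
odd `p` in `GreenbergVatsalTateKummer`.

THE PRINTED PROOF, FOLLOWED (Greenberg, LNM 1716, §2, proof of Prop. 2.4, pp. 74–75).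
`K = (F_∞)_η`, `G = G_K = (ker κ)_v ≤ Γ_{F_v}`, `C = C_v = ι⁻¹Ψ(μ)` the Tate line. Print:
"`G_K` has `p`-cohomological dimension `1`. Hence `H¹(K, C_v)` must be divisible." In the tree
`cd_p((ker κ)_v) ≤ 1` is `Greenberg1999.groupCdLE_one_localSubgroup_kerSubgroup_of_isCyclotomic`
(file `Greenberg1999/LocalH1DivisibleCyclotomicProofs`), and the divisibility is extracted in
cochain form from the short exact sequence `0 → C[2] → C →² C → 0` of discrete `G`-modules by
Greenberg's Lemma 4.5 (`exists_eq_nsmul_of_isSES_of_subsingleton_two`):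
* §1 `exists_mem_plus_two_nsmul_eq` — `C` is `2`-divisible (`C ≅ μ_{p^∞}`): square roots of
  roots of unity under `Ψ` for `p = 2` (torsion of `E(K̄_v)` is algebraic, `torsionPointsEquiv`),
  `(p^k+1)/2` for odd `p` (`exists_half_of_isOfFinOrder`);
* §2 `exists_eq_two_smul_add_coboundary` (generic: a `2`-divisible `p`-primary discrete module
  over a group with `cd_p ≤ 1`) and `exists_cocycle_eq_two_nsmul_add_of_isCyclotomic` — every
  continuous `C`-valued `1`-cocycle `g` of `(ker κ)_v` is `2d + ∂c₀` with `d` again a continuous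
  `C`-valued cocycle and `c₀ ∈ C` (`F : Type`, the universe of the `cd ≤ 1` theorem).
This REPLACES the pointwise halving of the odd-`p` proof — the only place where `p ≠ 2` is used
there; the sibling file runs the remaining (Tate parametrisation / continuous Hilbert 90) steps.

## References
* R. Greenberg, *Iwasawa theory for elliptic curves*, LNM 1716 (1999), §2 Prop. 2.4 (pp. 74–75)
  and pp. 75–76; §4 Lemma 4.5. [GreenbergLNM1716]
* J.-P. Serre, *Cohomologie galoisienne*, I §2.2, II §3.3 Prop. 9. [SerreGaloisCohomology1997]
* J. H. Silverman, *Advanced Topics in the Arithmetic of Elliptic Curves*, V.3.1.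
  [SilvermanATAEC1994]
-/

noncomputable section

open scoped Classical

universe u

namespace Summit.BirchSwinnertonDyer.Rank1Residual.X2.GreenbergVatsalTateKummerTwoDivisible

open CategoryTheory NumberField IsDedekindDomain Field
  Literature.NumberTheory.GaloisRepresentations Literature.NumberTheory.EllipticCurves
  Literature.NumberTheory.EllipticCurves.GreenbergSelmer IsDedekindDomain.HeightOneSpectrum
  Summit.BirchSwinnertonDyer.Rank1Residual.X2.GreenbergVatsalTateKummerLocal

/-! ## §1. `C = ι⁻¹Ψ(μ)` is `2`-divisible (square roots of roots of unity under `Ψ`) -/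

section Divisible

variable {F : Type u} [Field F] [NumberField F] (W : WeierstrassCurve F) [W.IsElliptic] (p : ℕ)
  [hp : Fact p.Prime] {v : HeightOneSpectrum (𝓞 F)}
  (Ψ : Additive (AlgebraicClosure (v.adicCompletion F))ˣ →+ localPoints W (v.adicCompletion F))
  (N : LocalDatum F (W.geomPrimaryTorsion p) v)
  (hN : ∀ m : W.geomPrimaryTorsion p, m ∈ N.plus ↔
    ∃ ζ : (AlgebraicClosure (v.adicCompletion F))ˣ, IsOfFinOrder ζ ∧
      Ψ (Additive.ofMul ζ) = pointsMap W (v.adicCompletion F) (m : W.geomPoints))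

include hN in
/-- **`C = ι⁻¹Ψ(μ)` is `2`-divisible**: every `m ∈ C` is `2 m'` with `m' ∈ C`. For odd `p` take
`m' = (p^k+1)/2 • m` (`exists_half_of_isOfFinOrder`); for `p = 2` take a square root `ξ` of the root
of unity `ζ` with `Ψ(ζ) = ι m`: `Ψ(ξ)` is a torsion point of `E(K̄_v)`, hence `ι` of a geometric
torsion point `m'` (`torsionPointsEquiv`, torsion is algebraic), which is `2`-power torsion and lies
in `C` with witness `ξ`. (`C ≅ μ_{p^∞}` is divisible — Greenberg LNM 1716 p. 75.)
[cite: GreenbergLNM1716, §2 pp. 75–76] [cite: SilvermanATAEC1994, Ch. V Thm. 3.1 (c)] -/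
theorem exists_mem_plus_two_nsmul_eq (m : W.geomPrimaryTorsion p) (hm : m ∈ N.plus) :
    ∃ m' : W.geomPrimaryTorsion p, m' ∈ N.plus ∧ 2 • m' = m := by
  obtain ⟨ζ, hζ, hζe⟩ := (hN m).1 hm
  by_cases hp2 : p ≠ 2
  · obtain ⟨m', ζ', h2, hζ', hζ'e⟩ := exists_half_of_isOfFinOrder W p Ψ hp2 m hζ hζe
    exact ⟨m', (hN m').2 ⟨ζ', hζ', hζ'e⟩, h2⟩
  · push Not at hp2
    subst hp2
    set Kv := v.adicCompletion F with hKv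
    set L := AlgebraicClosure Kv with hL
    -- a square root `ξ` of `ζ`
    obtain ⟨z, hz⟩ := IsAlgClosed.exists_pow_nat_eq (ζ : L) two_pos
    have hz0 : z ≠ 0 := by
      intro h
      rw [h, zero_pow two_ne_zero] at hz
      exact ζ.ne_zero hz.symm
    set ξ : Lˣ := Units.mk0 z hz0 with hξ
    have hξ2 : ξ ^ 2 = ζ := Units.ext (by rw [Units.val_pow_eq_pow_val, Units.val_mk0, hz])
    have hξfin : IsOfFinOrder ξ := by
      obtain ⟨n, hn, hζn⟩ := isOfFinOrder_iff_pow_eq_one.1 hζ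
      exact isOfFinOrder_iff_pow_eq_one.2 ⟨2 * n, by omega, by rw [pow_mul, hξ2, hζn]⟩
    -- `T = Ψ(ξ)` is a torsion point of `E(K̄_v)` with `2 T = ι m`
    set T : localPoints W Kv := Ψ (Additive.ofMul ξ) with hT
    have h2T : 2 • T = pointsMap W Kv (m : W.geomPoints) := by
      rw [hT, ← map_nsmul, ← ofMul_pow, hξ2, hζe]
    set n₀ : ℕ := orderOf ξ with hn₀
    have hn₀pos : 0 < n₀ := hξfin.orderOf_pos
    have hTn : (n₀ : ℤ) • T = 0 := by
      rw [natCast_zsmul, hT, ← map_nsmul, ← ofMul_pow, pow_orderOf_eq_one, ofMul_one, map_zero]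
    have hn₀z : (n₀ : ℤ) ≠ 0 := by exact_mod_cast hn₀pos.ne'
    have hTmem : T ∈ AddSubgroup.torsionBy (localPoints W Kv) (n₀ : ℤ) :=
      (Submodule.mem_torsionBy_iff (n₀ : ℤ) T).2 hTn
    -- the geometric torsion point `P` with `ι P = T`
    set P : W.geomTorsion (n₀ : ℤ) :=
      (W.torsionPointsEquiv (n₀ : ℤ) (E := Kv) hn₀z).symm ⟨T, hTmem⟩ with hP
    have hιP : pointsMap W Kv (P : W.geomPoints) = T := by
      rw [hP, WeierstrassCurve.pointsMap_torsionPointsEquiv_symm]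
    have hinj : Function.Injective (pointsMap W Kv) :=
      pointsMapOfEmb_injective W (closureEmb (K := F) Kv)
    -- `P` is `2`-power torsion
    obtain ⟨k, hk⟩ := (AddCommGroup.mem_primaryComponent).1 m.2
    have hPprim : (P : W.geomPoints) ∈ W.geomPrimaryTorsion 2 := by
      refine (AddCommGroup.mem_primaryComponent).2 ⟨k + 1, ?_⟩
      apply hinj
      rw [map_nsmul, map_zero, hιP, pow_succ, mul_nsmul', h2T, ← map_nsmul, hk, map_zero]
    refine ⟨⟨(P : W.geomPoints), hPprim⟩, (hN _).2 ⟨ξ, hξfin, ?_⟩, ?_⟩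
    · change Ψ (Additive.ofMul ξ) = pointsMap W Kv (P : W.geomPoints)
      rw [hιP]
    · apply Subtype.ext
      apply hinj
      rw [AddSubmonoidClass.coe_nsmul, map_nsmul]
      change 2 • pointsMap W Kv (P : W.geomPoints) = _
      rw [hιP, h2T]

end Divisible

/-! ## §2. Print's `cd_p(G_K) ≤ 1 ⟹ H¹(K, C_v)` divisible, in cochain form, for `K = (F_∞)_η` -/

section Generic

variable {Γ : Type u} [Group Γ] [TopologicalSpace Γ] [IsTopologicalGroup Γ] [CompactSpace Γ]
  {M : Type u} [AddCommGroup M] [TopologicalSpace M] [DiscreteTopology M]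

/-- **Greenberg's Lemma 4.5 / proof of Prop. 2.4 in cochain form, for the prime `2`:** for a
discrete `Γ`-module `M` which is `2`-divisible and `p`-primary, `cd_p(Γ) ≤ 1` makes every continuous
`1`-cocycle `φ` of `Γ` in `M` equal to `2ψ + ∂w` for a continuous `1`-cocycle `ψ` and a `w ∈ M`
(exactness of `H¹(Γ, M) →² H¹(Γ, M) → H²(Γ, M[2]) = 0` for `0 → M[2] → M →² M → 0`,
`exists_eq_nsmul_of_isSES_of_subsingleton_two`, read back on cocycles).
[cite: GreenbergLNM1716, §4 Lemma 4.5; §2 proof of Prop. 2.4 (p. 75)]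
[cite: SerreGaloisCohomology1997, I §2.2, II §3.3 Prop. 9] -/
theorem exists_eq_two_smul_add_coboundary (ρ : ContinuousRep Γ ℤ M) {p : ℕ}
    (hM : IsPrimaryTorsion p M) (hcd : GroupCdLE Γ p 1)
    (hdiv : Function.Surjective fun m : M => (2 : ℤ) • m) (φ : contOneCocycles ρ.toTopRep) :
    ∃ (ψ : contOneCocycles ρ.toTopRep) (w : M),
      ∀ τ, φ.1 τ = ((2 : ℕ) : ℤ) • ψ.1 τ + (ρ.toTopRep.ρ τ w - w) := by
  -- the `2`-torsion subrepresentation and the two morphisms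
  let T : Submodule ℤ M := Submodule.torsionBy ℤ M (2 : ℤ)
  have hT : ∀ σ : Γ, T ≤ T.comap (ρ σ) := by
    intro σ m hm
    rw [Submodule.mem_comap, Submodule.mem_torsionBy_iff, ← map_smul,
      (Submodule.mem_torsionBy_iff (2 : ℤ) m).1 hm, map_zero]
  let ρT : ContinuousRep Γ ℤ T := ρ.subrepresentation T hT
  let ι : ρT.toTopRep ⟶ ρ.toTopRep :=
    TopRep.ofHom ⟨⟨T.subtype, continuous_subtype_val⟩, fun σ => by ext m; rfl⟩
  let π : ρ.toTopRep ⟶ ρ.toTopRep :=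
    TopRep.ofHom ⟨⟨(2 : ℤ) • LinearMap.id, continuous_of_discreteTopology⟩, fun σ => by
      apply ContinuousLinearMap.ext
      intro m
      change (2 : ℤ) • (ρ σ m) = ρ σ ((2 : ℤ) • m)
      rw [map_smul]⟩
  have hSES : IsSES ι π :=
    { comp_eq_zero := by
        ext m
        exact (Submodule.mem_torsionBy_iff (2 : ℤ) (m : M)).1 m.2
      injective := Subtype.val_injective
      exact_mid := fun y hy => ⟨⟨y, (Submodule.mem_torsionBy_iff (2 : ℤ) y).2 hy⟩, rfl⟩
      surjective := hdiv }
  -- `H¹(π) = 2`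
  have hπ : ∀ y : continuousCohomology 1 ρ.toTopRep, cohomologyMap π 1 y = (2 : ℕ) • y := by
    intro y
    obtain ⟨ψ, rfl⟩ := oneCocycleClass_surjective ρ.toTopRep y
    rw [cohomologyMap_oneCocycleClass, ← Nat.cast_smul_eq_nsmul ℤ 2]
    have h1 : contOneCocycles.pullback (ContinuousMonoidHom.id _) (resIdHom π) ψ = (2 : ℤ) • ψ :=
      Subtype.ext (ContinuousMap.ext fun σ => rfl)
    rw [h1]
    exact oneCocycleClass_smul (X := ρ.toTopRep) (2 : ℤ) ψ
  -- `H²(Γ, M[2]) = 0` from `cd_p(Γ) ≤ 1` (`M[2] ⊆ M` is `p`-primary)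
  have hTp : IsPrimaryTorsion p T := by
    intro t
    obtain ⟨k, hk⟩ := hM (t : M)
    exact ⟨k, Subtype.ext (by rw [Submodule.coe_smul_of_tower, hk]; rfl)⟩
  have h2 : Subsingleton (continuousCohomology 2 ρT.toTopRep) :=
    hcd T ρT hTp (by norm_num : 1 < 2)
  -- the class of `φ` is `2 • [ψ]`; read back on cocycles
  obtain ⟨c', hc'⟩ := exists_eq_nsmul_of_isSES_of_subsingleton_two hSES hπ h2
    (oneCocycleClass ρ.toTopRep φ)
  obtain ⟨ψ, rfl⟩ := oneCocycleClass_surjective ρ.toTopRep c'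
  have h0 : oneCocycleClass ρ.toTopRep (φ - ((2 : ℕ) : ℤ) • ψ) = 0 := by
    rw [oneCocycleClass_sub, oneCocycleClass_smul, Nat.cast_smul_eq_nsmul, hc', sub_self]
  obtain ⟨w, hw⟩ := (oneCocycleClass_eq_zero_iff ρ.toTopRep (φ - ((2 : ℕ) : ℤ) • ψ)).1 h0
  refine ⟨ψ, w, fun τ => ?_⟩
  have h := hw τ
  rw [Submodule.coe_sub, Submodule.coe_smul, ContinuousMap.sub_apply, ContinuousMap.smul_apply,
    sub_eq_iff_eq_add] at h
  rw [h]
  abel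

end Generic

section Cyclotomic

variable {F : Type} [Field F] [NumberField F] (W : WeierstrassCurve F) (p : ℕ)
  [hp : Fact p.Prime] (κ : ZpExtension F p) {v : HeightOneSpectrum (𝓞 F)}
  (N : LocalDatum F (W.geomPrimaryTorsion p) v)

/-- **Greenberg, LNM 1716, proof of Prop. 2.4 (p. 75): "`G_K` has `p`-cohomological dimension `1`.
Hence `H¹(K, C_v)` must be divisible", for `K = (F_∞)_η` the completion of the CYCLOTOMIC
`ℤ_p`-extension at a place above `v`, in cochain form and for the prime `2`:** if `C = M⁺_v` is
`2`-divisible, then every continuous `C`-valued `1`-cocycle `g` of `G = (ker κ)_v` is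
`2 d + ∂c₀` with `d` a continuous `C`-valued `1`-cocycle and `c₀ ∈ C`. Proof:
`cd_p((ker κ)_v) ≤ 1` (`Greenberg1999.groupCdLE_one_localSubgroup_kerSubgroup_of_isCyclotomic`)
and `exists_eq_two_smul_add_coboundary` for the discrete `G`-module `C ⊆ E[p^∞]` (`p`-primary).
[cite: GreenbergLNM1716, §2 proof of Prop. 2.4 (pp. 74–75); §4 Lemma 4.5]
[cite: SerreGaloisCohomology1997, II §3.3 Prop. 9] -/
theorem exists_cocycle_eq_two_nsmul_add_of_isCyclotomic (hκ : κ.IsCyclotomic)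
    (hdiv : ∀ m : W.geomPrimaryTorsion p, m ∈ N.plus → ∃ m' : W.geomPrimaryTorsion p,
      m' ∈ N.plus ∧ 2 • m' = m)
    (g : localSubgroup κ.kerSubgroup (v.adicCompletion F) → W.geomPrimaryTorsion p)
    (hgC : ∀ τ, g τ ∈ N.plus) (hgcont : Continuous g)
    (hgcoc : ∀ τ₁ τ₂, g (τ₁ * τ₂) =
      g τ₁ + resGal (K := F) (v.adicCompletion F)
        (τ₁ : absoluteGaloisGroup (v.adicCompletion F)) • g τ₂) :
    ∃ (d : localSubgroup κ.kerSubgroup (v.adicCompletion F) → W.geomPrimaryTorsion p)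
      (c₀ : W.geomPrimaryTorsion p),
      (∀ τ, d τ ∈ N.plus) ∧ c₀ ∈ N.plus ∧ Continuous d ∧
      (∀ τ₁ τ₂, d (τ₁ * τ₂) =
        d τ₁ + resGal (K := F) (v.adicCompletion F)
          (τ₁ : absoluteGaloisGroup (v.adicCompletion F)) • d τ₂) ∧
      ∀ τ, g τ = 2 • d τ + (resGal (K := F) (v.adicCompletion F)
        (τ : absoluteGaloisGroup (v.adicCompletion F)) • c₀ - c₀) := by
  -- notation
  let Kv := v.adicCompletion F
  let Γv := absoluteGaloisGroup Kv
  let G : Subgroup Γv := localSubgroup κ.kerSubgroup Kv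
  let M : Type := ↥N.plus
  haveI : CompactSpace Γv := absoluteGaloisGroup_compactSpace Kv
  have hGclosed : IsClosed ((G : Subgroup Γv) : Set Γv) := by
    change IsClosed ((localSubgroup κ.kerSubgroup Kv : Subgroup Γv) : Set Γv)
    rw [localSubgroup_eq_comap, Subgroup.coe_comap]
    exact κ.isClosed_kerSubgroup.preimage (map_continuous (resGal (K := F) Kv))
  haveI : CompactSpace G := isCompact_iff_compactSpace.mp hGclosed.isCompact
  -- the discrete `G`-module `M = C = M⁺_v` as a `ContinuousRep`
  let act : G → M →+ M := fun σ =>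
    { toFun := fun m => ⟨resGal (K := F) Kv (σ : Γv) • (m : W.geomPrimaryTorsion p),
        N.smul_mem (σ : Γv) m.2⟩
      map_zero' := Subtype.ext (smul_zero _)
      map_add' := fun a b => Subtype.ext (smul_add _ _ _) }
  have hact : ∀ (σ : G) (m : M), ((act σ m : M) : W.geomPrimaryTorsion p) =
      resGal (K := F) Kv (σ : Γv) • (m : W.geomPrimaryTorsion p) := fun _ _ => rfl
  let ρ0 : Representation ℤ G M :=
    { toFun := fun σ => (act σ).toIntLinearMap
      map_one' := by
        refine LinearMap.ext fun m => Subtype.ext ?_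
        change ((act 1 m : M) : W.geomPrimaryTorsion p) = (m : W.geomPrimaryTorsion p)
        rw [hact, Subgroup.coe_one, map_one, one_smul]
      map_mul' := fun σ τ => by
        refine LinearMap.ext fun m => Subtype.ext ?_
        change ((act (σ * τ) m : M) : W.geomPrimaryTorsion p) =
          ((act σ (act τ m) : M) : W.geomPrimaryTorsion p)
        rw [hact, hact, hact, Subgroup.coe_mul, map_mul, mul_smul] }
  have hρ0 : ∀ (σ : G) (m : M), ((ρ0 σ m : M) : W.geomPrimaryTorsion p) =
      resGal (K := F) Kv (σ : Γv) • (m : W.geomPrimaryTorsion p) := fun _ _ => rfl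
  have hstab : ∀ m : M, {σ : G | ρ0 σ m = m} ∈ nhds (1 : G) := by
    intro m
    have hcont : Continuous fun σ : G =>
        resGal (K := F) Kv (σ : Γv) • (m : W.geomPrimaryTorsion p) :=
      (W.continuous_smul_geomPrimaryTorsion p (m : W.geomPrimaryTorsion p)).comp
        ((resGal (K := F) Kv).continuous_toFun.comp continuous_subtype_val)
    have hopen : IsOpen {σ : G | ρ0 σ m = m} := by
      have h := (isOpen_discrete {(m : W.geomPrimaryTorsion p)}).preimage hcont
      convert h using 1
      ext σ
      simp only [Set.mem_setOf_eq, Set.mem_preimage, Set.mem_singleton_iff]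
      rw [Subtype.ext_iff, hρ0]
    refine hopen.mem_nhds ?_
    simp only [Set.mem_setOf_eq]
    apply Subtype.ext
    rw [hρ0, Subgroup.coe_one, map_one, one_smul]
  let ρM : ContinuousRep G ℤ M := ContinuousRep.ofStabilizerMemNhdsOne ρ0 hstab
  have hρM : ∀ (σ : G) (m : M), ((ρM.toTopRep.ρ σ m : M) : W.geomPrimaryTorsion p) =
      resGal (K := F) Kv (σ : Γv) • (m : W.geomPrimaryTorsion p) := fun _ _ => rfl
  -- hypotheses of the generic lemma
  have hMp : IsPrimaryTorsion p M := by
    intro m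
    obtain ⟨k, hk⟩ := (AddCommGroup.mem_primaryComponent).1 ((m : M) : W.geomPrimaryTorsion p).2
    refine ⟨k, Subtype.ext (Subtype.ext ?_)⟩
    rw [AddSubmonoidClass.coe_nsmul, AddSubmonoidClass.coe_nsmul, hk]
    rfl
  have hcd := Greenberg1999.groupCdLE_one_localSubgroup_kerSubgroup_of_isCyclotomic (K := F) hκ v
  have hdivM : Function.Surjective fun m : M => (2 : ℤ) • m := by
    intro m
    obtain ⟨m', hm', h2⟩ := hdiv (m : W.geomPrimaryTorsion p) m.2
    refine ⟨⟨m', hm'⟩, Subtype.ext ?_⟩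
    change (((2 : ℤ) • (⟨m', hm'⟩ : M) : M) : W.geomPrimaryTorsion p) = (m : W.geomPrimaryTorsion p)
    rw [← natCast_zsmul] at h2
    exact h2
  -- the cocycle `g` as a continuous `1`-cocycle of `ρM`
  let φ : contOneCocycles ρM.toTopRep :=
    ⟨⟨fun τ => (⟨g τ, hgC τ⟩ : M), hgcont.subtype_mk _⟩, fun τ₁ τ₂ => by
      apply Subtype.ext
      change g (τ₁ * τ₂) =
        g τ₁ + ((ρM.toTopRep.ρ τ₁ (⟨g τ₂, hgC τ₂⟩ : M) : M) : W.geomPrimaryTorsion p)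
      rw [hρM, hgcoc]⟩
  have hφ : ∀ τ, ((φ.1 τ : M) : W.geomPrimaryTorsion p) = g τ := fun _ => rfl
  obtain ⟨ψ, w, hψ⟩ := exists_eq_two_smul_add_coboundary ρM hMp hcd hdivM φ
  refine ⟨fun τ => ((ψ.1 τ : M) : W.geomPrimaryTorsion p), (w : W.geomPrimaryTorsion p),
    fun τ => (ψ.1 τ).2, w.2, continuous_subtype_val.comp ψ.1.continuous, fun τ₁ τ₂ => ?_,
    fun τ => ?_⟩
  · show ((ψ.1 (τ₁ * τ₂) : M) : W.geomPrimaryTorsion p) =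
      ((ψ.1 τ₁ : M) : W.geomPrimaryTorsion p) + resGal (K := F) Kv (τ₁ : Γv) •
        ((ψ.1 τ₂ : M) : W.geomPrimaryTorsion p)
    rw [ψ.2 τ₁ τ₂, AddSubgroup.coe_add, hρM]
  · show g τ = 2 • ((ψ.1 τ : M) : W.geomPrimaryTorsion p) +
      (resGal (K := F) Kv (τ : Γv) • (w : W.geomPrimaryTorsion p) - (w : W.geomPrimaryTorsion p))
    rw [← hφ, hψ τ, AddSubgroup.coe_add, AddSubgroupClass.coe_sub, AddSubgroupClass.coe_zsmul,
      natCast_zsmul, hρM]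

end Cyclotomic

end Summit.BirchSwinnertonDyer.Rank1Residual.X2.GreenbergVatsalTateKummerTwoDivisible

end
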